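import Summits.QuantumFields.BalabanUV.Beta.WardLocusS0N
import Summits.QuantumFields.BalabanUV.Beta.ValueHessianBlind
import Summits.QuantumFields.BalabanUV.Beta.SpineRootedStepN
import Summits.QuantumFields.BalabanUV.Beta.GAN24.StencilSlotLamDrift

/-!
# `BalabanUV.Beta.WardLocusStep` — binder row D1, the WARD binder hW at the steps `j ≥ 1`: Λ-NULL AT EVERY LEVEL (the value Hessian
# kills pure gauges — an1's (W-LH-E2)_j, pointwise), the step border dictionary, and the (W-LS)_{j ≥ 1} socket reduced to the
# value-function cubic sector

HONEST FRAMING (cell charter, verbatim): «discharging `BetaPertH` makes Bałaban's UV stability UNCONDITIONAL — a real constructive-QFT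
result; it is NOT the continuum limit and NOT the Clay problem.»  DERIVED cell leaf (pub-balaban β sub-cell, D1 formalisation swarm seat
`b2b-balaban-beta-d1-formalise-leaf-10`; sequel of `WardLocusStencils` p208946 / `WardLocusS0N` p209131 on an1-g25's hW skeleton
`HOME/b2b-balaban-beta-an1-g25/SKELETON-D1-hW.v1.md` §2, items (W-LH-E2)_j and (W-LS)_{j ≥ 1}); every declaration is [folklore] kernel
algebra over objects ALREADY in the tree, cited BY NAME; no statement of Bałaban's papers is typed, no `[cite:]` tag, no `def … : Prop`;
it instantiates NO binder of the β-function wall.  NOT `BetaPertH`, NOT continuum, NOT Clay.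
HONEST DEPENDENCY (cell records, verbatim): «continuum YM on T⁴ ⇐ BetaPertH ∧ nine spine estimates (0/9 proved); BetaPertH ⇐ (D1) ∧ (D4) ∧
CAP+tail; G-an2-4 gates asym, D1 and NE2/3/4.»
ABSOLUTE RULE (cell charter, verbatim): «No internally-minted statement may enter as a cited fact. Every hypothesis is either kernel-proved in
this package or a verbatim quotation of a PUBLISHED theorem with page reference. The manuscript(s) under audit are NOT citable for their own
disputed steps — they are the thing under adjudication; programme-internal (2001/route/tribunal) claims are never citable.»

WHAT IS HERE.
* §1 `divV_SLam_eq_zero_of_coeffDiv` — for ANY coefficient family `c` with zero fine divergence `Σ_κ′ (c μ y κ′ (u − e_κ′) − c μ y κ′ u) = 0`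
  (and the `locStencil_SLam` summability), `divV (SLam N c Q2) u = 0`.
* §2 **(W-LH-E2)_j, POINTWISE**: `E2_colDiv_eq_zero` — the value Hessian `E2 d Lc j` (= `wΦ (Lc^j)` on the field block, an2's
  `ValueHessianBlind.E2_inl_inl_eq_wΦ`) KILLS THE PURE GAUGE `d δ_u` in its column index:
  `Σ_κ′ (E2 w (u − e_κ′) f (inl κ′) − E2 w u f (inl κ′)) = 0` — it is an2's second-slot co-closedness `codiff₁_wΦ_right` read entrywise.
  Hence `sum_lamCoeffK_div_eq_zero`: the step multiplier response `lamCoeffK A E N = (A ∘ E)_{(inr,inl)}` has zero fine divergence for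
  every decaying `A` whenever `E` kills pure gauges, and **`divV_SLam_lamCoeffK_E2_eq_zero`** / **`divV_SstepNAt`**: the Λ-part of
  Bałaban's native step stencil `SstepNAt ρ cE cVH cΛ j` drops out of `divV` at EVERY `j`:
  `divV (SstepNAt ρ … j) u = (cE·wE j) • divV (e3NAtOf ρ … j) u + (cVH·wVH j) • divV (vhSAt ρ) u`.
* §3 the STEP border dictionary: `conjV (bhKStepAt d ρ Lc (j+1)) (diagK (legInd ρ u)) = conjV (ffK (bhKStepAt …)) (diagK (legInd ρ u))
  − (stepScale (j+1) · Lc^{d+1}) • divV (vhSAt ρ d Lc) u` (border of `bhKStepAt (j+1)` = `stepScale •` border of `bhKAt`, an2 p206071).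
* §4 the (W-LS)_{j+1} socket `hSd` reduced to the VALUE-FUNCTION CUBIC SECTOR: `hSd_defect_SstepNAt`, and `hSd_SstepNAt_of_e3Ward` — IF
  `divV (e3NAtOf ρ … (j+1)) u = c3 • conjV (ffK (bhKStepAt d ρ Lc (j+1))) (diagK (legInd ρ u))` (STATEMENT-LEVEL, like hR's (L3); NOT proved)
  then `hSd` holds at level `j+1` for every `(cH, ξ)` with `cH·(cE·wE (j+1))·c3 = ξ`, `cH·(cVH·wVH (j+1)) = −ξ·stepScale (j+1)·Lc^{d+1}`
  (solvability: `WardLocusS0N.lock_solvable_iff` with `P := stepScale (j+1)·Lc^{d+1}`).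
Nothing here asserts the cubic Ward law; nothing printed is a hypothesis.
-/

noncomputable section

open Finset
open scoped BigOperators
open Literature.Probability.LatticeModels (Torus.proj)
open Literature.MathematicalPhysics.QuantumFieldTheory
open Literature.MathematicalPhysics.QuantumFieldTheory.Balaban1983to89
open Literature.MathematicalPhysics.QuantumFieldTheory.Balaban1983to89.Beta
open B12Sec2to5 (l1 l1_nonneg)
open ExpKernelCalculus (MKer Decays BiLoc VertexFamily comp)
open OneStepResolventKernel (Fib decays_mono biLoc_mono)
open OneStepKernelFamily (KInvStep decays_KInvStep)
open KernelWard (divV)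
open StepJetData (mfNeg mfNeg_inl_inr mfNeg_inr_inl)
open AffineAveraging (box toSite codiff₁)
open AveragingHessianKernelsRooted (vhSAt hessFFAt biLoc_hessFFAt)
open AveragingHessianKernels (ell)
open AveragingWardStencils (b6UnitVec_eq)
open InterLevelTransport (SLam cwsum_apply)
open BalabanStepJetsSucc (lamCoeffK abs_lamCoeffK_le E2 decays_E2 wE wVH wΛ)
open KernelSpecInstance (wΦ)
open Summit.QuantumFields.BalabanUV.Beta.ChartConjugation (conjV)
open Summit.QuantumFields.BalabanUV.Beta.BorderedHessian (bhKAt bhKStepAt stepScale bhKStepAt_succ_inl_inl bhKStepAt_succ_fm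
  bhKStepAt_succ_mf bhKStepAt_succ_mm diagK diagK_apply conjV_diagK_apply E2_inl_inl_eq_wΦ E2_inr codiff₁_wΦ_right)
open Summit.QuantumFields.BalabanUV.Beta.AveragingWardRootedStencils (linSymAt legInd divV_vhSAt_apply)
open Summit.QuantumFields.BalabanUV.Beta.SpineRooted (SstepNAt e3NAtOf)
open Summit.QuantumFields.BalabanUV.Beta.WardLocusStencils
open Summit.QuantumFields.BalabanUV.Beta.WardLocusS0N (conjV_diagK_smul conjV_diagK_sum)
open Summit.QuantumFields.BalabanUV.Beta.GAN24.StencilSlotLamDrift (summable_compTerm_dd)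

namespace Summit.QuantumFields.BalabanUV.Beta.WardLocusStep

variable {d : ℕ}

/-! ## §1 Λ-null for ANY divergence-free coefficient family -/

section Generic

variable {N : ℕ} [NeZero N]

/-- [folklore] **THE LAGRANGE STENCIL OF A DIVERGENCE-FREE COEFFICIENT FAMILY HAS ZERO DIVERGENCE**: if every coarse superposition
series of `SLam N c Q2` is summable and `Σ_κ′ (c μ y κ′ (u − e_κ′) − c μ y κ′ u) = 0`, then `divV (SLam N c Q2) u = 0`. -/
theorem divV_SLam_eq_zero_of_coeffDiv {c : Fin (d + 1) → (Fin (d + 1) → ℤ) → Fin (d + 1) → (Fin (d + 1) → ℤ) → ℝ}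
    {Q2 : Fin (d + 1) → (Fin (d + 1) → ℤ) → MKer (d + 1) (Fib d)}
    (hs : ∀ (μ κ' : Fin (d + 1)) (u x z : Fin (d + 1) → ℤ) (a b : Fib d), Summable fun y : Fin (d + 1) → ℤ => c μ y κ' u * Q2 μ y x z a b)
    (hdiv : ∀ (μ : Fin (d + 1)) (y u : Fin (d + 1) → ℤ),
      ∑ κ' : Fin (d + 1), (c μ y κ' (u - AffineAveraging.unitVec κ') - c μ y κ' u) = 0)
    (u : Fin (d + 1) → ℤ) : divV (SLam N c Q2) u = 0 := by
  funext x z a b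
  rw [divV_apply]
  simp only [SLam, Pi.zero_apply, cwsum_apply, neg_sub_neg]
  have key : ∑ κ' : Fin (d + 1), ((∑ μ, ∑' y, c μ y κ' (u - B6BondElimination.unitVec κ') * Q2 μ y x z a b) -
      (∑ μ, ∑' y, c μ y κ' u * Q2 μ y x z a b)) = 0 := by
    simp only [← Finset.sum_sub_distrib, b6UnitVec_eq]
    rw [Finset.sum_comm]
    refine Finset.sum_eq_zero fun μ _ => ?_
    have hsub : ∀ κ' : Fin (d + 1),
        (∑' y, c μ y κ' (u - AffineAveraging.unitVec κ') * Q2 μ y x z a b) - (∑' y, c μ y κ' u * Q2 μ y x z a b) =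
          ∑' y, (c μ y κ' (u - AffineAveraging.unitVec κ') - c μ y κ' u) * Q2 μ y x z a b := by
      intro κ'
      rw [← (hs μ κ' _ x z a b).tsum_sub (hs μ κ' u x z a b)]
      exact tsum_congr fun y => by ring
    simp only [hsub]
    have hs2 : ∀ κ' ∈ (Finset.univ : Finset (Fin (d + 1))), Summable fun y : Fin (d + 1) → ℤ =>
        (c μ y κ' (u - AffineAveraging.unitVec κ') - c μ y κ' u) * Q2 μ y x z a b :=
      fun κ' _ => ((hs μ κ' (u - AffineAveraging.unitVec κ') x z a b).sub (hs μ κ' u x z a b)).congr (fun y => by ring)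
    rw [← Summable.tsum_finsetSum hs2]
    refine (tsum_congr fun y => ?_).trans tsum_zero
    rw [← Finset.sum_mul, hdiv, zero_mul]
  rw [Finset.sum_sub_distrib, sub_eq_zero] at key
  rw [Finset.sum_sub_distrib, key, sub_self]

/-- [folklore] **THE STEP MULTIPLIER RESPONSE HAS ZERO FINE DIVERGENCE WHENEVER THE VALUE HESSIAN KILLS PURE GAUGES**: for decaying `A`, `E`
with `Σ_κ′ (E w (u − e_κ′) f (inl κ′) − E w u f (inl κ′)) = 0` (all `w, u, f`):
`Σ_κ′ (lamCoeffK A E N μ y κ′ (u − e_κ′) − lamCoeffK A E N μ y κ′ u) = 0`. -/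
theorem sum_lamCoeffK_div_eq_zero {A E : MKer (d + 1) (Fib d)} {CA CE δ : ℝ} (hA : Decays A CA δ) (hE : Decays E CE δ) (hδ : 0 < δ)
    (hEcol : ∀ (w u : Fin (d + 1) → ℤ) (f : Fib d),
      ∑ κ' : Fin (d + 1), (E w (u - AffineAveraging.unitVec κ') f (Sum.inl κ') - E w u f (Sum.inl κ')) = 0)
    (N : ℕ) (μ : Fin (d + 1)) (y u : Fin (d + 1) → ℤ) :
    ∑ κ' : Fin (d + 1), (lamCoeffK A E N μ y κ' (u - AffineAveraging.unitVec κ') - lamCoeffK A E N μ y κ' u) = 0 := by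
  have hs : ∀ (u' : Fin (d + 1) → ℤ) (κ' : Fin (d + 1)),
      Summable fun w : Fin (d + 1) → ℤ => ∑ f, A ((N : ℤ) • y) w (Sum.inr μ) f * E w u' f (Sum.inl κ') :=
    fun u' κ' => summable_compTerm_dd hA hE hδ _ _ _ _
  simp only [lamCoeffK, ExpKernelCalculus.comp]
  have hsub : ∀ κ' : Fin (d + 1),
      (∑' w, ∑ f, A ((N : ℤ) • y) w (Sum.inr μ) f * E w (u - AffineAveraging.unitVec κ') f (Sum.inl κ')) -
        (∑' w, ∑ f, A ((N : ℤ) • y) w (Sum.inr μ) f * E w u f (Sum.inl κ')) =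
      ∑' w, ∑ f, A ((N : ℤ) • y) w (Sum.inr μ) f *
        (E w (u - AffineAveraging.unitVec κ') f (Sum.inl κ') - E w u f (Sum.inl κ')) := by
    intro κ'
    rw [← (hs _ κ').tsum_sub (hs u κ')]
    refine tsum_congr fun w => ?_
    rw [← Finset.sum_sub_distrib]
    exact Finset.sum_congr rfl fun f _ => by ring
  simp only [hsub]
  have hs2 : ∀ κ' ∈ (Finset.univ : Finset (Fin (d + 1))), Summable fun w : Fin (d + 1) → ℤ =>
      ∑ f, A ((N : ℤ) • y) w (Sum.inr μ) f * (E w (u - AffineAveraging.unitVec κ') f (Sum.inl κ') - E w u f (Sum.inl κ')) := by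
    intro κ' _
    refine (((hs (u - AffineAveraging.unitVec κ') κ').sub (hs u κ'))).congr fun w => ?_
    rw [← Finset.sum_sub_distrib]
    exact Finset.sum_congr rfl fun f _ => by ring
  rw [← Summable.tsum_finsetSum hs2]
  refine (tsum_congr fun w => ?_).trans tsum_zero
  rw [Finset.sum_comm]
  refine Finset.sum_eq_zero fun f _ => ?_
  rw [← Finset.mul_sum, hEcol, mul_zero]

end Generic

/-! ## §2 (W-LH-E2)_j pointwise: the value Hessian kills pure gauges; Λ-null at every step -/

section ValueHessian

variable {Lc : ℕ} [NeZero Lc]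

/-- [folklore] **(W-LH-E2)_j, POINTWISE**: the value Hessian `E2 d Lc j` kills the pure gauge `d δ_u` in its column index —
`Σ_κ′ (E2 w (u − e_κ′) f (inl κ′) − E2 w u f (inl κ′)) = 0` for all `w, u, f` (field rows: an2's `codiff₁_wΦ_right` through
`E2_inl_inl_eq_wΦ`; multiplier rows: `E2_inr`). -/
theorem E2_colDiv_eq_zero (j : ℕ) (w u : Fin (d + 1) → ℤ) (f : Fib d) :
    ∑ κ' : Fin (d + 1), (E2 d Lc j w (u - AffineAveraging.unitVec κ') f (Sum.inl κ') - E2 d Lc j w u f (Sum.inl κ')) = 0 := by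
  rcases f with κ | m
  · simp only [E2_inl_inl_eq_wΦ]
    have h := congr_fun (codiff₁_wΦ_right (N := Lc ^ j) (d := d) κ w) u
    simpa only [codiff₁, Pi.zero_apply, sub_sub_eq_add_sub, add_sub] using h
  · simp only [E2_inr, sub_self, Finset.sum_const_zero]

/-- [folklore] Hence the step multiplier response through the value Hessian has zero fine divergence, for every decaying `A`. -/
theorem sum_lamCoeffK_E2_div_eq_zero (j : ℕ) {A : MKer (d + 1) (Fib d)} {CA δ : ℝ} (hA : Decays A CA δ) (hδ : 0 < δ) (N : ℕ)
    (μ : Fin (d + 1)) (y u : Fin (d + 1) → ℤ) :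
    ∑ κ' : Fin (d + 1), (lamCoeffK A (E2 d Lc j) N μ y κ' (u - AffineAveraging.unitVec κ') - lamCoeffK A (E2 d Lc j) N μ y κ' u) = 0 := by
  obtain ⟨δE, CE, hδE, hCE, hE⟩ := decays_E2 (d := d) (Lc := Lc) j
  have hCA : 0 ≤ CA := hA.nonneg (Sum.inl 0)
  have hn : 0 < min δ δE := lt_min hδ hδE
  exact sum_lamCoeffK_div_eq_zero (decays_mono hA hCA le_rfl (min_le_left _ _)) (decays_mono hE hCE le_rfl (min_le_right _ _)) hn
    (E2_colDiv_eq_zero j) N μ y u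

/-- [folklore] **Λ-NULL AT EVERY STEP, POINTWISE**: `divV (SLam N (lamCoeffK A (E2 d Lc j)) Q2) u = 0` for every decaying `A` (blocking `N`)
and every second-jet family `Q2` localised at the coarse bonds. -/
theorem divV_SLam_lamCoeffK_E2_eq_zero {N : ℕ} [NeZero N] (j : ℕ) {A : MKer (d + 1) (Fib d)} {CA δ : ℝ} (hA : Decays A CA δ) (hδ : 0 < δ)
    {Q2 : Fin (d + 1) → (Fin (d + 1) → ℤ) → MKer (d + 1) (Fib d)} {Cq δq : ℝ} (hQ : VertexFamily Q2 N Cq δq) (hδq : 0 < δq)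
    (u : Fin (d + 1) → ℤ) : divV (SLam N (lamCoeffK A (E2 d Lc j) N) Q2) u = 0 := by
  obtain ⟨δE, CE, hδE, hCE, hE⟩ := decays_E2 (d := d) (Lc := Lc) j
  have hCA : 0 ≤ CA := hA.nonneg (Sum.inl 0)
  have hCq : 0 ≤ Cq := (hQ 0 0).nonneg (Sum.inl 0)
  -- common rate `n` for `A`, `E2 j` (coefficients then decay at rate `n/2`) and `Q2`
  set n : ℝ := min (min δ δE) (2 * δq) with hn
  have hn0 : 0 < n := lt_min (lt_min hδ hδE) (by linarith)
  have hA' : Decays A CA n := decays_mono hA hCA le_rfl ((min_le_left _ _).trans (min_le_left _ _))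
  have hE' : Decays (E2 d Lc j) CE n := decays_mono hE hCE le_rfl ((min_le_left _ _).trans (min_le_right _ _))
  have hc := abs_lamCoeffK_le hA' hE' hn0 N
  have hQ' : VertexFamily Q2 N Cq (n / 2) := fun μ y => biLoc_mono (hQ μ y) hCq (by
    have : n ≤ 2 * δq := min_le_right _ _
    linarith)
  have hs := summable_lamCoeff_mul (N := N) hc hQ' (by positivity)
    (mul_nonneg (mul_nonneg (Nat.cast_nonneg _) (mul_nonneg hCA hCE)) (ExpKernelCalculus.Zl_nonneg (by linarith)))
  exact divV_SLam_eq_zero_of_coeffDiv hs (sum_lamCoeffK_E2_div_eq_zero j hA hδ N) u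

/-- [folklore] **THE DIVERGENCE OF BAŁABAN'S NATIVE STEP STENCIL HAS NO Λ-PART, AT EVERY `j`** (in-block root):
`divV (SstepNAt ρ cE cVH cΛ j) u = (cE·wE j) • divV (e3NAtOf ρ cE cVH cΛ j) u + (cVH·wVH j) • divV (vhSAt ρ) u`. -/
theorem divV_SstepNAt (hLc : 1 ≤ Lc) {r : Fin (d + 1) → ℕ} (hr : r ∈ box (d + 1) Lc) (cE cVH cΛ : ℝ) (j : ℕ) (u : Fin (d + 1) → ℤ) :
    divV (SstepNAt d Lc (toSite r) cE cVH cΛ j) u =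
      (cE * wE d Lc j) • divV (e3NAtOf d Lc (toSite r) cE cVH cΛ j) u + (cVH * wVH d Lc j) • divV (vhSAt (toSite r) d Lc) u := by
  obtain ⟨δA, CA, hδA, hCA, hA⟩ := decays_KInvStep (Lc := Lc) (d := d) j
  have hQ : VertexFamily (fun μ y => hessFFAt (toSite r) Lc μ y) Lc (2 * (ell (d + 1) Lc : ℝ) ^ 2 * Real.exp (4 * ((d : ℝ) + 1) * Lc * δA)) δA :=
    fun μ y => biLoc_hessFFAt hLc μ y hr hδA.le
  have hΛ := divV_SLam_lamCoeffK_E2_eq_zero (Lc := Lc) (N := Lc) j hA hδA hQ hδA u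
  funext x z a b
  have hΛ' := congr_fun (congr_fun (congr_fun (congr_fun hΛ x) z) a) b
  simp only [divV_apply, Pi.zero_apply, Finset.sum_sub_distrib] at hΛ'
  simp only [divV_apply, Pi.add_apply, Pi.smul_apply, smul_eq_mul, SstepNAt, Finset.sum_add_distrib, Finset.sum_sub_distrib,
    ← Finset.mul_sum]
  linear_combination (cΛ * wΛ d Lc j) * hΛ'

end ValueHessian

/-! ## §3 The step border dictionary -/

section StepDictionary

variable (ρ : Fin (d + 1) → ℤ) (Lc : ℕ) [NeZero Lc]

/-- [folklore] **THE DIAGONAL CONTACT OF THE STEP BORDERED HESSIAN**: at step `j+1` the border is `stepScale (j+1) •` that of `bhKAt`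
(an2 p206071), so `conjV (bhKStepAt d ρ Lc (j+1)) (diagK (legInd ρ u)) = conjV (ffK (bhKStepAt d ρ Lc (j+1))) (diagK (legInd ρ u))
− (stepScale (j+1) · Lc^{d+1}) • divV (vhSAt ρ d Lc) u`. -/
theorem conjV_bhKStepAt_succ_diagK_legInd (hLc : 1 ≤ Lc) (j : ℕ) (u : Fin (d + 1) → ℤ) :
    conjV (bhKStepAt d ρ Lc (j + 1)) (diagK (legInd ρ u)) =
      conjV (ffK (bhKStepAt d ρ Lc (j + 1))) (diagK (legInd ρ u)) -
        (stepScale d Lc (j + 1) * (Lc : ℝ) ^ (d + 1)) • divV (vhSAt ρ d Lc) u := by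
  funext x z a b
  simp only [Pi.sub_apply, Pi.smul_apply, smul_eq_mul, conjV_diagK_apply, divV_vhSAt_apply hLc]
  rcases a with κ | κ <;> rcases b with l | l
  · rw [ffK_inl_inl, StepJetData.mfNeg_inl_inl, AveragingWardRootedStencils.linSymAt_inl_inl]; ring
  · rw [ffK_inl_inr, mfNeg_inl_inr, bhKStepAt_succ_fm, bhKAt_inl_inr_eq_linSymAt]; ring
  · rw [ffK_inr_inl, mfNeg_inr_inl, bhKStepAt_succ_mf, bhKAt_inr_inl_eq_linSymAt]; ring
  · rw [ffK_inr_inr, StepJetData.mfNeg_inr_inr, AveragingWardRootedStencils.linSymAt_inr_inr, bhKStepAt_succ_mm]; ring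

end StepDictionary

/-! ## §4 (W-LS)_{j+1}: the socket `hSd` at the steps reduced to the value-function cubic sector -/

section StepSocket

variable {Lc : ℕ} [NeZero Lc]

/-- [folklore] **THE STEP SOCKET SPLIT INTO ITS SECTORS**: for the native step stencil `SstepNAt ρ cE cVH cΛ (j+1)`, `𝕄_{j+1} = bhKStepAt d ρ Lc (j+1)`
and the diagonal block-rotation generator with symbol `ξ • Σ_v legInd ρ (Lc•y + v)`:
`cH • Σ_v divV SstepNAt − conjV 𝕄_{j+1} (X y) = [cH·cE·wE • Σ_v divV e3NAtOf − ξ • Σ_v conjV (ffK 𝕄_{j+1}) (diagK (legInd ρ ·))]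
+ (cH·cVH·wVH + ξ·stepScale·Lc^{d+1}) • Σ_v divV (vhSAt ρ)`. -/
theorem hSd_defect_SstepNAt (hLc : 1 ≤ Lc) {r : Fin (d + 1) → ℕ} (hr : r ∈ box (d + 1) Lc) (cE cVH cΛ cH ξ : ℝ) (j : ℕ)
    (y : Fin (d + 1) → ℤ) :
    cH • ∑ v ∈ box (d + 1) Lc, divV (SstepNAt d Lc (toSite r) cE cVH cΛ (j + 1)) ((Lc : ℤ) • y + toSite v) -
        conjV (bhKStepAt d (toSite r) Lc (j + 1)) (diagK (ξ • ∑ v ∈ box (d + 1) Lc, legInd (toSite r) ((Lc : ℤ) • y + toSite v))) =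
      ((cH * (cE * wE d Lc (j + 1))) • ∑ v ∈ box (d + 1) Lc, divV (e3NAtOf d Lc (toSite r) cE cVH cΛ (j + 1)) ((Lc : ℤ) • y + toSite v) -
          ξ • ∑ v ∈ box (d + 1) Lc,
            conjV (ffK (bhKStepAt d (toSite r) Lc (j + 1))) (diagK (legInd (toSite r) ((Lc : ℤ) • y + toSite v)))) +
        (cH * (cVH * wVH d Lc (j + 1)) + ξ * (stepScale d Lc (j + 1) * (Lc : ℝ) ^ (d + 1))) •
          ∑ v ∈ box (d + 1) Lc, divV (vhSAt (toSite r) d Lc) ((Lc : ℤ) • y + toSite v) := by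
  rw [conjV_diagK_smul, conjV_diagK_sum]
  simp only [divV_SstepNAt hLc hr, conjV_bhKStepAt_succ_diagK_legInd (toSite r) Lc hLc, Finset.sum_add_distrib, Finset.sum_sub_distrib,
    Finset.smul_sum, smul_add, smul_sub, smul_smul, add_smul]
  funext x z a b
  simp only [Pi.add_apply, Pi.sub_apply, Pi.smul_apply, Finset.sum_apply, smul_eq_mul]
  ring

/-- [folklore] **`hSd` AT STEP `j+1` FROM A CUBIC WARD LAW AND THE SCALAR LOCK.**  IF the value-function cubic stencil obeys, pointwise,
`divV (e3NAtOf ρ cE cVH cΛ (j+1)) u = c3 • conjV (ffK (bhKStepAt d ρ Lc (j+1))) (diagK (legInd ρ u))` (a SOCKET — statement-level like hR's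
(L3); NOT proved here) then the socket `hSd` of `KernelWardRelative.wardTransversal_flipK_hessKer_conj_rel` holds at level `j+1` for every
`(cH, ξ)` with `cH·(cE·wE (j+1))·c3 = ξ` and `cH·(cVH·wVH (j+1)) = −ξ·stepScale (j+1)·Lc^{d+1}`. -/
theorem hSd_SstepNAt_of_e3Ward (hLc : 1 ≤ Lc) {r : Fin (d + 1) → ℕ} (hr : r ∈ box (d + 1) Lc) {cE cVH cΛ cH ξ c3 : ℝ} {j : ℕ}
    (hW : ∀ u : Fin (d + 1) → ℤ, divV (e3NAtOf d Lc (toSite r) cE cVH cΛ (j + 1)) u =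
      c3 • conjV (ffK (bhKStepAt d (toSite r) Lc (j + 1))) (diagK (legInd (toSite r) u)))
    (h₁ : cH * (cE * wE d Lc (j + 1)) * c3 = ξ) (h₂ : cH * (cVH * wVH d Lc (j + 1)) = -(ξ * (stepScale d Lc (j + 1) * (Lc : ℝ) ^ (d + 1))))
    (y : Fin (d + 1) → ℤ) :
    cH • ∑ v ∈ box (d + 1) Lc, divV (SstepNAt d Lc (toSite r) cE cVH cΛ (j + 1)) ((Lc : ℤ) • y + toSite v) =
      conjV (bhKStepAt d (toSite r) Lc (j + 1)) (diagK (ξ • ∑ v ∈ box (d + 1) Lc, legInd (toSite r) ((Lc : ℤ) • y + toSite v))) := by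
  rw [← sub_eq_zero, hSd_defect_SstepNAt hLc hr]
  have hv : cH * (cVH * wVH d Lc (j + 1)) + ξ * (stepScale d Lc (j + 1) * (Lc : ℝ) ^ (d + 1)) = 0 := by rw [h₂]; ring
  rw [hv, zero_smul, add_zero, sub_eq_zero]
  simp only [hW, Finset.smul_sum, smul_smul, h₁.symm]

end StepSocket

end Summit.QuantumFields.BalabanUV.Beta.WardLocusStep

end
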